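import Summits.QuantumFields.YangMills.Theorems.BalabanUVNodesN07PlateCaccioppoliBiharmonic
import Summits.QuantumFields.YangMills.Theorems.BalabanUVNodesN07TorusBoxCutoff
import Literature.Analysis.PDE.GiaquintaIterationLemma
import HarnessLib

/-!
# DAG node N07 — THE INTERIOR PLATE-ENERGY ESTIMATE FOR DISCRETE BIHARMONIC FUNCTIONS ON THE TORUS:
# `Σ_{B_ρ}(Δh)² ≤ C(d)·(r − ρ)⁻⁴·Σ_{B_r} h²` (road item (L2) ∕ socket (S3), order two)

Width seat `pub-ymgap-dag-n07-w7` (g6), count-neutral helper (`--supports … --as helper`).  Assembles this seat's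
`…N07PlateCaccioppoliBiharmonic.biharmonic_plate_step` (p639356: the hole-filling step with cut-offs as hypotheses), the box
cut-offs `…N07TorusBoxCutoff.exists_torusBoxCutoff`, and the tree's Giaquinta iteration lemma
`Literature.Analysis.PDE.Giaquinta1983.lemma_V_3_1` (θ = ½, α = 4).

WHAT.  Boxes are carried as a hypothesis `hB : x ∈ B ρ ↔ ∀ i, |valMinAbs(x_i − z_i)| ≤ ρ` (no definition is introduced).
* §1 box bookkeeping (`box_mono`, `shift_mem_box`, `mem_box_of_shift_mem`);
* §2 ★★ `energy_step_boxes`: for `Δ²h = 0` on `B(ρ + 4w)` (`1 ≤ ρ`, `1 ≤ w`, `2(ρ + 4w) + 7 ≤ N`, `0 < d`):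
  `Σ_{B ρ}(Δh)² ≤ ½·Σ_{B(ρ+4w)}(Δh)² + 135424·d²·w⁻⁴·Σ_{B(ρ+4w)} h²`;
* §3 `sum_box_lap_sq_le` (crude: `Σ_{B(r−1)}(Δh)² ≤ 18d²·Σ_{B r} h²`);
* §4 ★★★ `biharmonic_interior_estimate`: `∃ C = C(d) ≥ 0`, for every torus, centre, `h` biharmonic on `B r`, `1 ≤ ρ`,
  `ρ + 2 ≤ r`, `2r + 5 ≤ N`: `Σ_{B ρ}(Δh)² ≤ C·(r − ρ)⁻⁴·Σ_{B r} h²`.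

HONEST SCOPE.  Finite-difference bookkeeping + the iteration lemma; asserts NOTHING about [B11]∕[B6]∕[3]; orders 1 and 3, the
robust one-level inequality in x-space and the assembly (S4)–(S5) of the (L4) road are NOT here; (P)_D for Bałaban's `d = 4`
geometries OPEN; `hker` at the record, stub 1, K0⁷ ∕ K1⁹ NOT closed; N07 not discharged; nothing continuum ∕ OS ∕ mass gap.
Context only: M. Giaquinta (1983) Ch. III §2, Ch. V Lemma 3.1 [Giaquinta1984]; T. Bałaban, CMP **96** (1984) 223–250
[Balaban1984PropagatorsII] (1.9), (2.22).
-/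

set_option autoImplicit false

noncomputable section

open Finset

namespace Summit.QuantumFields.YangMills.Theorems.N07BiharmonicInteriorEstimate

open Literature.Probability.LatticeModels (TorusSite)
open Summit.QuantumFields.YangMills.Theorems.N07PointFeasibilityEnergyIdentity (fd lap)
open Summit.QuantumFields.YangMills.Theorems.N07TorusBoxCutoff (exists_torusBoxCutoff)
open Literature.MathematicalPhysics.QuantumFieldTheory.BalabanImbrieJaffe1984to88.BIJ85TorusTentCutoff (natAbs_valMinAbs_succ_le natAbs_valMinAbs_le_succ)
open Summit.QuantumFields.YangMills.Theorems.N07PlateCaccioppoliBiharmonic (biharmonic_plate_step)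

variable {d N : ℕ} [NeZero N]

/-! ## §1  Boxes on the torus (as a hypothesis `hB`) -/

section Boxes

variable (z : TorusSite d N) (B : ℕ → Finset (TorusSite d N))
  (hB : ∀ (ρ : ℕ) (x : TorusSite d N), x ∈ B ρ ↔ ∀ i, (x i - z i).valMinAbs.natAbs ≤ ρ)

include hB

omit [NeZero N] in
/-- Boxes increase with the radius. [folklore] -/
theorem box_mono {ρ ρ' : ℕ} (h : ρ ≤ ρ') : B ρ ⊆ B ρ' := by
  intro x hx; rw [hB] at hx ⊢; exact fun i => (hx i).trans h

omit [NeZero N] in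
/-- One lattice step leaves the next box: `x ∈ B ρ ⇒ x ± eₖ ∈ B (ρ+1)`. [folklore] -/
theorem shift_mem_box (hN : 3 ≤ N) {ρ : ℕ} {x : TorusSite d N} (hx : x ∈ B ρ) (k : Fin d) :
    x + Pi.single k 1 ∈ B (ρ + 1) ∧ x - Pi.single k 1 ∈ B (ρ + 1) := by
  rw [hB] at hx
  constructor
  · rw [hB]; intro i
    by_cases hik : i = k
    · subst hik
      rw [Pi.add_apply, Pi.single_eq_same, show x i + 1 - z i = (x i - z i) + 1 by ring]
      exact (natAbs_valMinAbs_succ_le hN _).trans (by have := hx i; omega)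
    · rw [Pi.add_apply, Pi.single_eq_of_ne hik, add_zero]; exact (hx i).trans (Nat.le_succ ρ)
  · rw [hB]; intro i
    by_cases hik : i = k
    · subst hik
      rw [Pi.sub_apply, Pi.single_eq_same]
      have h1 := natAbs_valMinAbs_le_succ hN (x i - 1 - z i)
      rw [show x i - 1 - z i + 1 = x i - z i by ring] at h1
      have := hx i; omega
    · rw [Pi.sub_apply, Pi.single_eq_of_ne hik, sub_zero]; exact (hx i).trans (Nat.le_succ ρ)

omit [NeZero N] in
/-- Conversely `x + eₖ ∈ B ρ` or `x − eₖ ∈ B ρ` puts `x ∈ B (ρ+1)`. [folklore] -/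
theorem mem_box_of_shift_mem (hN : 3 ≤ N) {ρ : ℕ} {x : TorusSite d N} (k : Fin d)
    (hx : x + Pi.single k 1 ∈ B ρ ∨ x - Pi.single k 1 ∈ B ρ) : x ∈ B (ρ + 1) := by
  rcases hx with hx | hx
  · have := (shift_mem_box z B hB hN hx k).2
    rwa [add_sub_cancel_right] at this
  · have := (shift_mem_box z B hB hN hx k).1
    rwa [sub_add_cancel] at this

end Boxes

/-! ## §2  The hole-filling step between boxes -/

section Step

variable (z : TorusSite d N) (B : ℕ → Finset (TorusSite d N))
  (hB : ∀ (ρ : ℕ) (x : TorusSite d N), x ∈ B ρ ↔ ∀ i, (x i - z i).valMinAbs.natAbs ≤ ρ)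

include hB

/-- ★★ **The energy step between boxes.**  If `Δ²h = 0` on `B(ρ + 4w)` (`1 ≤ ρ`, `1 ≤ w`, `2(ρ + 4w) + 7 ≤ N`, `0 < d`) then
`Σ_{B ρ}(Δh)² ≤ ½·Σ_{B(ρ+4w)}(Δh)² + 135424·d²·w⁻⁴·Σ_{B(ρ+4w)} h²`
(`biharmonic_plate_step` at the box cut-offs of radii `ρ + w − 1` (inner, width `w`) and `ρ + 3w` (outer), `δ = 2∕w`). [folklore] -/
theorem energy_step_boxes (h : TorusSite d N → ℝ) (hd : 0 < d) {ρ w : ℕ} (hρ : 1 ≤ ρ) (hw : 1 ≤ w)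
    (hN : 2 * (ρ + 4 * w) + 7 ≤ N) (hbi : ∀ x ∈ B (ρ + 4 * w), lap (lap h) x = 0) :
    ∑ x ∈ B ρ, lap h x ^ 2 ≤
      (1 / 2) * ∑ x ∈ B (ρ + 4 * w), lap h x ^ 2 +
        135424 * (d : ℝ) ^ 2 / (w : ℝ) ^ 4 * ∑ x ∈ B (ρ + 4 * w), h x ^ 2 := by
  classical
  have hN3 : 3 ≤ N := by omega
  have hw0 : (0 : ℝ) < w := by exact_mod_cast hw
  -- the two cut-offs
  obtain ⟨χ, hχ01, hχ1, hχ0, hχd1, hχd2⟩ :=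
    exists_torusBoxCutoff (d := d) z (R := ρ + w - 1) (w := w) hw (by omega) (by omega)
  obtain ⟨ψ, hψ01, hψ1, hψ0, hψd1, hψd2⟩ :=
    exists_torusBoxCutoff (d := d) z (R := ρ + 3 * w) (w := w) hw (by omega) (by omega)
  -- where the cut-offs live
  have hχsupp : ∀ x, χ x ≠ 0 → x ∈ B (ρ + 2 * w - 2) := by
    intro x hx
    rw [hB]; intro i
    by_contra hcon
    exact hx (hχ0 x ⟨i, by omega⟩)
  have hψsupp : ∀ x, ψ x ≠ 0 → x ∈ B (ρ + 4 * w - 1) := by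
    intro x hx
    rw [hB]; intro i
    by_contra hcon
    exact hx (hψ0 x ⟨i, by omega⟩)
  -- δ = 2/w and the two comparisons
  set δ : ℝ := 2 / w with hδ
  have hδ0 : 0 < δ := by positivity
  have h1w : 1 / (w : ℝ) ≤ δ := div_le_div_of_nonneg_right (by norm_num) hw0.le
  have h2w : 2 / (w : ℝ) ^ 2 ≤ δ ^ 2 := by
    rw [hδ, div_pow]; exact div_le_div_of_nonneg_right (by norm_num) (by positivity)
  -- hypotheses of the plate step
  have Hbi : ∀ x, χ x ≠ 0 → lap (lap h) x = 0 :=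
    fun x hx => hbi x (box_mono z B hB (by omega) (hχsupp x hx))
  have Hχ1 : ∀ i x, |fd i χ x| ≤ δ := fun i x => (hχd1 i x).trans h1w
  have Hχ2 : ∀ i j x, |fd j (fd i χ) x| ≤ δ ^ 2 := fun i j x => (hχd2 j i x).trans h2w
  have Hψ1 : ∀ i x, |fd i ψ x| ≤ δ := fun i x => (hψd1 i x).trans h1w
  have hψone : ∀ y ∈ B (ρ + 2 * w + 1), ψ y = 1 := fun y hy =>
    hψ1 y (fun i => by rw [hB] at hy; have := hy i; omega)
  -- where χ varies
  have hvar : ∀ i y, fd i χ y ≠ 0 → y ∈ B (ρ + 2 * w - 1) := by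
    intro i y hne
    have hor : χ y ≠ 0 ∨ χ (y + Pi.single i 1) ≠ 0 := by
      by_contra hcon; push Not at hcon; apply hne; simp only [fd, hcon.1, hcon.2, sub_zero]
    rcases hor with h1 | h1
    · exact box_mono z B hB (by omega) (hχsupp y h1)
    · have h2 := mem_box_of_shift_mem z B hB hN3 i (Or.inl (hχsupp _ h1))
      have e : ρ + 2 * w - 2 + 1 = ρ + 2 * w - 1 := by omega
      rwa [e] at h2
  have Hχψ : ∀ i y, fd i χ y ≠ 0 → ψ y = 1 ∧
      (∀ k : Fin d, ψ (y + Pi.single k 1) = 1 ∧ ψ (y - Pi.single k 1) = 1) ∧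
      (∀ k l : Fin d, ψ (y + Pi.single k 1 + Pi.single l 1) = 1 ∧ ψ (y + Pi.single k 1 - Pi.single l 1) = 1 ∧
        ψ (y - Pi.single k 1 - Pi.single l 1) = 1) := by
    intro i y hne
    have hy := hvar i y hne
    have hy1 : ∀ k : Fin d, y + Pi.single k 1 ∈ B (ρ + 2 * w) ∧ y - Pi.single k 1 ∈ B (ρ + 2 * w) := fun k => by
      have := shift_mem_box z B hB hN3 hy k
      rwa [show ρ + 2 * w - 1 + 1 = ρ + 2 * w by omega] at this
    have hy2 : ∀ k l : Fin d,
        (y + Pi.single k 1 + Pi.single l 1 ∈ B (ρ + 2 * w + 1) ∧ y + Pi.single k 1 - Pi.single l 1 ∈ B (ρ + 2 * w + 1)) ∧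
        (y - Pi.single k 1 + Pi.single l 1 ∈ B (ρ + 2 * w + 1) ∧ y - Pi.single k 1 - Pi.single l 1 ∈ B (ρ + 2 * w + 1)) :=
      fun k l => ⟨shift_mem_box z B hB hN3 (hy1 k).1 l, shift_mem_box z B hB hN3 (hy1 k).2 l⟩
    refine ⟨hψone y (box_mono z B hB (by omega) hy), fun k => ⟨?_, ?_⟩, fun k l => ⟨?_, ?_, ?_⟩⟩
    · exact hψone _ (box_mono z B hB (by omega) (hy1 k).1)
    · exact hψone _ (box_mono z B hB (by omega) (hy1 k).2)
    · exact hψone _ (hy2 k l).1.1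
    · exact hψone _ (hy2 k l).1.2
    · exact hψone _ (hy2 k l).2.2
  have HM : ∀ x, ψ x ≠ 0 → x ∈ B (ρ + 4 * w) ∧
      ∀ k : Fin d, x + Pi.single k 1 ∈ B (ρ + 4 * w) ∧ x - Pi.single k 1 ∈ B (ρ + 4 * w) := by
    intro x hx
    have hx' := hψsupp x hx
    refine ⟨box_mono z B hB (by omega) hx', fun k => ?_⟩
    have := shift_mem_box z B hB hN3 hx' k
    rwa [show ρ + 4 * w - 1 + 1 = ρ + 4 * w by omega] at this
  have step := biharmonic_plate_step h χ ψ hδ0 hd (B (ρ + 4 * w)) Hbi Hχ1 Hχ2 Hχψ hψ01 Hψ1 HM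
  -- the inner box
  have inner : ∑ x ∈ B ρ, lap h x ^ 2 ≤ ∑ x, χ x ^ 2 * lap h x ^ 2 := by
    calc ∑ x ∈ B ρ, lap h x ^ 2 = ∑ x ∈ B ρ, χ x ^ 2 * lap h x ^ 2 :=
          Finset.sum_congr rfl (fun x hx => by
            rw [hχ1 x (fun i => by rw [hB] at hx; have := hx i; omega)]; ring)
      _ ≤ ∑ x, χ x ^ 2 * lap h x ^ 2 :=
          Finset.sum_le_univ_sum_of_nonneg (fun x => by positivity)
  have hδ4 : 8464 * (d : ℝ) ^ 2 * δ ^ 4 = 135424 * (d : ℝ) ^ 2 / (w : ℝ) ^ 4 := by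
    rw [hδ]; field_simp; ring
  rw [hδ4] at step
  linarith [inner, step]

end Step

/-! ## §3  The crude bound `Σ_{B(r−1)}(Δh)² ≤ 18d²·Σ_{B r} h²` -/

section Crude

variable (z : TorusSite d N) (B : ℕ → Finset (TorusSite d N))
  (hB : ∀ (ρ : ℕ) (x : TorusSite d N), x ∈ B ρ ↔ ∀ i, (x i - z i).valMinAbs.natAbs ≤ ρ)

include hB

omit [NeZero N] in
/-- A shifted sum over a box is at most the sum over the next box (`f ≥ 0`). [folklore] -/
theorem sum_shift_box_le (hN : 3 ≤ N) (f : TorusSite d N → ℝ) (hf : ∀ x, 0 ≤ f x) (ρ : ℕ) (k : Fin d) :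
    ∑ x ∈ B ρ, f (x + Pi.single k 1) ≤ ∑ x ∈ B (ρ + 1), f x ∧
      ∑ x ∈ B ρ, f (x - Pi.single k 1) ≤ ∑ x ∈ B (ρ + 1), f x := by
  classical
  constructor
  · rw [← Finset.sum_image (f := f) (s := B ρ) (g := fun x => x + Pi.single k 1)
      (fun x _ y _ hxy => add_right_cancel hxy)]
    refine Finset.sum_le_sum_of_subset_of_nonneg (fun y hy => ?_) (fun y _ _ => hf y)
    obtain ⟨x, hx, rfl⟩ := Finset.mem_image.mp hy; exact (shift_mem_box z B hB hN hx k).1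
  · rw [← Finset.sum_image (f := f) (s := B ρ) (g := fun x => x - Pi.single k 1)
      (fun x _ y _ hxy => sub_left_injective hxy)]
    refine Finset.sum_le_sum_of_subset_of_nonneg (fun y hy => ?_) (fun y _ _ => hf y)
    obtain ⟨x, hx, rfl⟩ := Finset.mem_image.mp hy; exact (shift_mem_box z B hB hN hx k).2

omit [NeZero N] in
/-- **Crude bound**: `Σ_{B ρ}(Δh)² ≤ 18d²·Σ_{B(ρ+1)} h²` (no equation needed). [folklore] -/
theorem sum_box_lap_sq_le (hN : 3 ≤ N) (h : TorusSite d N → ℝ) (ρ : ℕ) :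
    ∑ x ∈ B ρ, lap h x ^ 2 ≤ 18 * (d : ℝ) ^ 2 * ∑ x ∈ B (ρ + 1), h x ^ 2 := by
  classical
  set H : ℝ := ∑ x ∈ B (ρ + 1), h x ^ 2 with hH
  -- pointwise
  have pt : ∀ x, lap h x ^ 2 ≤ 3 * (d : ℝ) * ∑ i, (h (x + Pi.single i 1) ^ 2 + h (x - Pi.single i 1) ^ 2 + 4 * h x ^ 2) := by
    intro x
    have h1 := sq_sum_le_card_mul_sum_sq (s := (Finset.univ : Finset (Fin d)))
      (f := fun i => h (x + Pi.single i 1) + h (x - Pi.single i 1) - 2 * h x)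
    simp only [Finset.card_univ, Fintype.card_fin] at h1
    have e : lap h x = ∑ i, (h (x + Pi.single i 1) + h (x - Pi.single i 1) - 2 * h x) := rfl
    rw [e]
    have h2 : ∀ i : Fin d, (h (x + Pi.single i 1) + h (x - Pi.single i 1) - 2 * h x) ^ 2 ≤
        3 * (h (x + Pi.single i 1) ^ 2 + h (x - Pi.single i 1) ^ 2 + 4 * h x ^ 2) := by
      intro i
      nlinarith [sq_nonneg (h (x + Pi.single i 1) - h (x - Pi.single i 1)),
        sq_nonneg (h (x + Pi.single i 1) + 2 * h x), sq_nonneg (h (x - Pi.single i 1) + 2 * h x)]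
    have h3 : (d : ℝ) * ∑ i, (h (x + Pi.single i 1) + h (x - Pi.single i 1) - 2 * h x) ^ 2 ≤
        (d : ℝ) * ∑ i, 3 * (h (x + Pi.single i 1) ^ 2 + h (x - Pi.single i 1) ^ 2 + 4 * h x ^ 2) :=
      mul_le_mul_of_nonneg_left (Finset.sum_le_sum (fun i _ => h2 i)) (Nat.cast_nonneg d)
    rw [← Finset.mul_sum] at h3
    linarith
  -- sum and reorganise
  have s1 : ∑ x ∈ B ρ, lap h x ^ 2 ≤
      ∑ x ∈ B ρ, 3 * (d : ℝ) * ∑ i, (h (x + Pi.single i 1) ^ 2 + h (x - Pi.single i 1) ^ 2 + 4 * h x ^ 2) :=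
    Finset.sum_le_sum (fun x _ => pt x)
  have s2 : ∑ x ∈ B ρ, ∑ i, (h (x + Pi.single i 1) ^ 2 + h (x - Pi.single i 1) ^ 2 + 4 * h x ^ 2) ≤ 6 * d * H := by
    rw [Finset.sum_comm]
    have perI : ∀ i : Fin d, ∑ x ∈ B ρ, (h (x + Pi.single i 1) ^ 2 + h (x - Pi.single i 1) ^ 2 + 4 * h x ^ 2) ≤ 6 * H := by
      intro i
      have a := (sum_shift_box_le z B hB hN (fun x => h x ^ 2) (fun x => sq_nonneg _) ρ i).1
      have b := (sum_shift_box_le z B hB hN (fun x => h x ^ 2) (fun x => sq_nonneg _) ρ i).2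
      have c : ∑ x ∈ B ρ, h x ^ 2 ≤ H :=
        Finset.sum_le_sum_of_subset_of_nonneg (box_mono z B hB (Nat.le_succ ρ)) (fun x _ _ => sq_nonneg _)
      rw [Finset.sum_add_distrib, Finset.sum_add_distrib, ← Finset.mul_sum]
      linarith
    calc ∑ i, ∑ x ∈ B ρ, (h (x + Pi.single i 1) ^ 2 + h (x - Pi.single i 1) ^ 2 + 4 * h x ^ 2)
        ≤ ∑ _i : Fin d, 6 * H := Finset.sum_le_sum (fun i _ => perI i)
      _ = 6 * d * H := by rw [Finset.sum_const, Finset.card_univ, Fintype.card_fin, nsmul_eq_mul]; ring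
  rw [← Finset.mul_sum] at s1
  have hd0 : (0 : ℝ) ≤ d := Nat.cast_nonneg d
  nlinarith [s1, s2, hd0]

end Crude

/-! ## §4  The interior estimate -/

/-- ★★★ **INTERIOR PLATE-ENERGY ESTIMATE FOR DISCRETE BIHARMONIC FUNCTIONS ON THE TORUS.**  There is `C = C(d) ≥ 0` such
that on every torus `(ℤ∕N)^d`, for every centre `z`, every `h` with `Δ²h = 0` on the box `B r` (torus sup-distance `≤ r`
from `z`), and all radii `1 ≤ ρ`, `ρ + 2 ≤ r` with `2r + 5 ≤ N`:
`Σ_{x∈B ρ} (Δh(x))² ≤ C·(r − ρ)⁻⁴·Σ_{x∈B r} h(x)²`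
(`energy_step_boxes` along the radii, absorbed by Giaquinta's iteration lemma with `θ = ½`, `α = 4`; small gaps by the crude
bound).  Boxes enter through the hypothesis `hB`. [folklore] -/
theorem biharmonic_interior_estimate (d : ℕ) (hd : 0 < d) : ∃ C : ℝ, 0 ≤ C ∧
    ∀ (N : ℕ) [NeZero N] (z : TorusSite d N) (B : ℕ → Finset (TorusSite d N)),
      (∀ (ρ : ℕ) (x : TorusSite d N), x ∈ B ρ ↔ ∀ i, (x i - z i).valMinAbs.natAbs ≤ ρ) →
      ∀ (h : TorusSite d N → ℝ) (ρ r : ℕ), 1 ≤ ρ → ρ + 2 ≤ r → 2 * r + 5 ≤ N →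
      (∀ x ∈ B r, lap (lap h) x = 0) →
      ∑ x ∈ B ρ, lap h x ^ 2 ≤ C / ((r : ℝ) - ρ) ^ 4 * ∑ x ∈ B r, h x ^ 2 := by
  classical
  obtain ⟨c, hc0, hc⟩ := Literature.Analysis.PDE.Giaquinta1983.lemma_V_3_1 (θ := 1 / 2) (α := 4)
    (by norm_num) (by norm_num) (by norm_num)
  set A₁ : ℝ := (32 : ℝ) ^ 4 * 135425 * (d : ℝ) ^ 2 with hA₁
  have hA₁0 : 0 ≤ A₁ := by positivity
  refine ⟨16 * c * A₁, by positivity, ?_⟩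
  intro N _ z B hB h ρ r hρ hρr hN hbi
  have hN3 : 3 ≤ N := by omega
  have hd0 : (0 : ℝ) < d := by exact_mod_cast hd
  -- letters
  set H : ℝ := ∑ x ∈ B r, h x ^ 2 with hH
  have hH0 : 0 ≤ H := Finset.sum_nonneg (fun x _ => sq_nonneg _)
  set E : ℕ → ℝ := fun m => ∑ x ∈ B m, lap h x ^ 2 with hE
  have hE0 : ∀ m, 0 ≤ E m := fun m => Finset.sum_nonneg (fun x _ => sq_nonneg _)
  have hEmono : ∀ m n, m ≤ n → E m ≤ E n := fun m n hmn =>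
    Finset.sum_le_sum_of_subset_of_nonneg (box_mono z B hB hmn) (fun x _ _ => sq_nonneg _)
  have hHmono : ∀ m, m ≤ r → ∑ x ∈ B m, h x ^ 2 ≤ H := fun m hm =>
    Finset.sum_le_sum_of_subset_of_nonneg (box_mono z B hB hm) (fun x _ _ => sq_nonneg _)
  -- the crude bound at the top: E (r - 1) ≤ 18 d² H
  have hcrude : E (r - 1) ≤ 18 * (d : ℝ) ^ 2 * H := by
    have := sum_box_lap_sq_le z B hB hN3 h (r - 1)
    rwa [show r - 1 + 1 = r by omega] at this
  -- the function on real radii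
  set f : ℝ → ℝ := fun s => E ⌊s⌋₊ with hf
  have hr1 : ((r - 1 : ℕ) : ℝ) = (r : ℝ) - 1 := by rw [Nat.cast_sub (by omega)]; simp
  -- Giaquinta's hypothesis on [ρ, r - 1]
  have hyp : ∀ t s : ℝ, (ρ : ℝ) ≤ t → t < s → s ≤ (r : ℝ) - 1 →
      f t ≤ (A₁ * H / (s - t) ^ (4 : ℝ) + 0) + (1 / 2) * f s := by
    intro t s ht hts hs
    have ht0 : 0 ≤ t := le_trans (Nat.cast_nonneg ρ) ht
    have hs0 : 0 ≤ s := le_trans ht0 hts.le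
    set m := ⌊t⌋₊ with hm
    set n := ⌊s⌋₊ with hn
    have hρm : ρ ≤ m := Nat.le_floor ht
    have hmn : m ≤ n := Nat.floor_le_floor hts.le
    have hnr : n ≤ r - 1 := by
      have : s ≤ ((r - 1 : ℕ) : ℝ) := by rw [hr1]; exact hs
      exact Nat.floor_le_of_le this
    have hsn : s < n + 1 := Nat.lt_floor_add_one s
    have hmt : (m : ℝ) ≤ t := Nat.floor_le ht0
    have hgap : s - t < (n : ℝ) - m + 1 := by linarith
    have hst0 : 0 < s - t := by linarith
    have hpow : (s - t) ^ (4 : ℝ) = (s - t) ^ (4 : ℕ) := by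
      rw [show (4 : ℝ) = ((4 : ℕ) : ℝ) by norm_num, Real.rpow_natCast]
    rw [hpow, add_zero]
    show E m ≤ A₁ * H / (s - t) ^ 4 + 1 / 2 * E n
    by_cases hq : 4 ≤ n - m
    · -- the step with w = (n - m) / 4
      set w := (n - m) / 4 with hw
      have hw1 : 1 ≤ w := by omega
      have hw4 : m + 4 * w ≤ n := by omega
      have hstep := energy_step_boxes z B hB h hd (ρ := m) (w := w) (by omega) hw1 (by omega)
        (fun x hx => hbi x (box_mono z B hB (by omega) hx))
      have e1 : E (m + 4 * w) ≤ E n := hEmono _ _ hw4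
      have e2 : ∑ x ∈ B (m + 4 * w), h x ^ 2 ≤ H := hHmono _ (by omega)
      -- (s - t) ≤ 32 w
      have hq' : (((n - m : ℕ) : ℝ)) = (n : ℝ) - m := Nat.cast_sub hmn
      have h32 : s - t ≤ 32 * (w : ℝ) := by
        have h4w : 4 * w + 3 ≥ n - m := by omega
        have : (4 : ℝ) * w + 3 ≥ (n : ℝ) - m := by rw [← hq']; exact_mod_cast h4w
        have hq4 : (4 : ℝ) ≤ (n : ℝ) - m := by rw [← hq']; exact_mod_cast hq
        linarith
      have hw0 : (0 : ℝ) < w := by exact_mod_cast hw1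
      have hcoef : 135424 * (d : ℝ) ^ 2 / (w : ℝ) ^ 4 * ∑ x ∈ B (m + 4 * w), h x ^ 2 ≤ A₁ * H / (s - t) ^ 4 := by
        have hst4 : 0 < (s - t) ^ 4 := pow_pos hst0 4
        have hw4 : 0 < (w : ℝ) ^ 4 := by positivity
        have hk : 135424 * (d : ℝ) ^ 2 / (w : ℝ) ^ 4 ≤ A₁ / (s - t) ^ 4 := by
          rw [div_le_div_iff₀ hw4 hst4, hA₁]
          have h4 : (s - t) ^ 4 ≤ (32 * (w : ℝ)) ^ 4 := pow_le_pow_left₀ hst0.le h32 4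
          have h5 := mul_le_mul_of_nonneg_left h4 (by positivity : (0 : ℝ) ≤ 135424 * (d : ℝ) ^ 2)
          have h6 : 0 ≤ (d : ℝ) ^ 2 * (w : ℝ) ^ 4 := by positivity
          nlinarith [h5, h6]
        calc 135424 * (d : ℝ) ^ 2 / (w : ℝ) ^ 4 * ∑ x ∈ B (m + 4 * w), h x ^ 2
            ≤ A₁ / (s - t) ^ 4 * H := mul_le_mul hk e2 (Finset.sum_nonneg (fun x _ => sq_nonneg _)) (by positivity)
          _ = A₁ * H / (s - t) ^ 4 := by ring
      have : E m ≤ 1 / 2 * E (m + 4 * w) + 135424 * (d : ℝ) ^ 2 / (w : ℝ) ^ 4 * ∑ x ∈ B (m + 4 * w), h x ^ 2 :=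
        hstep
      linarith
    · -- small gaps: the crude bound
      push Not at hq
      have hgap4 : s - t ≤ 4 := by
        have h3 : (n : ℝ) ≤ m + 3 := by exact_mod_cast (show n ≤ m + 3 by omega)
        linarith
      have hEm : E m ≤ 18 * (d : ℝ) ^ 2 * H := (hEmono m (r - 1) (hmn.trans hnr)).trans hcrude
      have hA : 18 * (d : ℝ) ^ 2 * H ≤ A₁ * H / (s - t) ^ 4 := by
        rw [le_div_iff₀ (pow_pos hst0 4)]
        have h4 : (s - t) ^ 4 ≤ (4 : ℝ) ^ 4 := pow_le_pow_left₀ hst0.le hgap4 4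
        rw [hA₁]
        have h5 := mul_le_mul_of_nonneg_left h4 (by positivity : (0 : ℝ) ≤ 18 * (d : ℝ) ^ 2 * H)
        have h6 : 0 ≤ (d : ℝ) ^ 2 * H := by positivity
        nlinarith [h5, h6]
      have := hE0 n
      linarith
  -- bounded above
  have hfL : ∀ s ∈ Set.Icc (ρ : ℝ) ((r : ℝ) - 1), f s ≤ ∑ x, lap h x ^ 2 := fun s _ =>
    Finset.sum_le_univ_sum_of_nonneg (fun x => sq_nonneg _)
  have main := hc f ρ ((r : ℝ) - 1) (A₁ * H) 0 (∑ x, lap h x ^ 2) (by positivity) le_rfl hfL hyp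
    ρ ((r : ℝ) - 1) le_rfl (by have h2 : ((ρ : ℝ)) + 2 ≤ r := (by exact_mod_cast hρr); linarith) le_rfl
  -- unpack: f ρ = E ρ, rpow → pow, (r - 1 - ρ)⁻⁴ ≤ 16 (r - ρ)⁻⁴
  have hfρ : f ρ = E ρ := by show E ⌊(ρ : ℝ)⌋₊ = E ρ; rw [Nat.floor_natCast]
  rw [hfρ, add_zero, show (4 : ℝ) = ((4 : ℕ) : ℝ) by norm_num, Real.rpow_natCast] at main
  have hρr' : ((ρ : ℝ)) + 2 ≤ r := by exact_mod_cast hρr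
  have hgap : ((r : ℝ) - ρ) / 2 ≤ (r : ℝ) - 1 - ρ := by linarith
  have hgap0 : 0 < ((r : ℝ) - ρ) / 2 := by linarith
  have hden : ((r : ℝ) - ρ) ^ 4 / 16 ≤ ((r : ℝ) - 1 - ρ) ^ 4 := by
    have := pow_le_pow_left₀ hgap0.le hgap 4
    calc ((r : ℝ) - ρ) ^ 4 / 16 = (((r : ℝ) - ρ) / 2) ^ 4 := by ring
      _ ≤ _ := this
  have hrρ : 0 < (r : ℝ) - ρ := by linarith
  calc E ρ ≤ c * (A₁ * H / ((r : ℝ) - 1 - ρ) ^ 4) := main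
    _ ≤ c * (A₁ * H / (((r : ℝ) - ρ) ^ 4 / 16)) := by
        refine mul_le_mul_of_nonneg_left ?_ hc0.le
        exact div_le_div_of_nonneg_left (by positivity) (div_pos (pow_pos hrρ 4) (by norm_num)) hden
    _ = 16 * c * A₁ / ((r : ℝ) - ρ) ^ 4 * H := by
        have hne : ((r : ℝ) - ρ) ^ 4 ≠ 0 := pow_ne_zero 4 (ne_of_gt hrρ)
        field_simp

end Summit.QuantumFields.YangMills.Theorems.N07BiharmonicInteriorEstimate

end
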